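import Summits.Ventures.PercRepro.S1CoreCapAvg
import Summits.Ventures.PercRepro.RankLevelSetCoreCircuitBounds
import Summits.Ventures.PercRepro.RankLevelSetCoreSixColoopFree

/-!
# PercRepro — THE AVERAGING RECURSION FOR THE 6-CIRCUITS, WITH THE COLOOP-FREE STEP (p8 g8, S3)

`proofs/SUBCLAIM-S3-p8.md` §3v. g6's RankLevelSetFiveCircuitAvg (p1's averaging recursion applied to the 5-circuits) WORD FOR
WORD for the 6-circuits: `Σ_x #6circ(x) = 6·s₆` (`sum_ncard_sixCircuitsThrough_eq`), some non-coloop `x` lies on at most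
`⌊6·s₆/m⌋` six-circuits (`exists_nonColoop_ncard_sixCircuitsThrough_le`), `s₆(M) ≤ #6circ(x) + s₆(M ＼ {x})`
(`ncard_sixCircuits_le_through_add_delete`), the step `s₆(d + 1) − ⌊6·s₆(d + 1)/(d + 6)⌋ ≤ s₆(d)` on a core of nullity
`d + 1 ≥ 7` (`ncard_sixCircuits_sub_div_le`) and, with the non-coloop count `m` as a parameter (g7's
`ncard_fiveCircuits_sub_div_le_of_nonColoops` for `k = 6`), **`ncard_sixCircuits_sub_div_le_of_nonColoops`**: on a
COLOOP-FREE core of `n` points, `s₆ ≤ ⌊n·S₆(d − 1)/(n − 6)⌋` from any cap `S₆(d − 1)` at nullity `d − 1` — from the crude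
`C(d + 4, 6)` this is `429308` against `C(29, 6) = 475020` at the parity cell `(25, 24)` of the `q = 6` window
(`n = 49`). Axioms: standard.
-/

open scoped Matroid

namespace PercRepro

namespace ThmN

open Set

variable {α : Type}

open Classical in
/-- **Double count**: over the points of the ground set, the 6-circuits through a point sum to `6 · s₆`. -/
theorem sum_ncard_sixCircuitsThrough_eq (M : Matroid α) [M.Finite] :
    ∑ x ∈ M.ground_finite.toFinset, {C : Set α | M.IsCircuit C ∧ C.ncard = 6 ∧ x ∈ C}.ncard =
      6 * {C : Set α | M.IsCircuit C ∧ C.ncard = 6}.ncard := by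
  have hS : {C : Set α | M.IsCircuit C ∧ C.ncard = 6}.Finite :=
    M.ground_finite.finite_subsets.subset (fun C hC => hC.1.subset_ground)
  set Sf := hS.toFinset with hSf
  have h1 : ∀ x, {C : Set α | M.IsCircuit C ∧ C.ncard = 6 ∧ x ∈ C}.ncard = (Sf.filter (fun C => x ∈ C)).card := by
    intro x
    rw [← ncard_coe_finset]
    congr 1
    ext C
    simp only [Finset.coe_filter, hSf, Set.Finite.mem_toFinset, mem_setOf_eq]
    tauto
  have h2 : ∀ C ∈ Sf, (M.ground_finite.toFinset.filter (fun x => x ∈ C)).card = 6 := by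
    intro C hC
    rw [hSf, Set.Finite.mem_toFinset] at hC
    have : (M.ground_finite.toFinset.filter (fun x => x ∈ C) : Set α) = C := by
      ext x
      simp only [Finset.coe_filter, Set.Finite.mem_toFinset, mem_setOf_eq]
      exact ⟨fun h => h.2, fun h => ⟨hC.1.subset_ground h, h⟩⟩
    rw [← ncard_coe_finset, this, hC.2]
  calc ∑ x ∈ M.ground_finite.toFinset, {C : Set α | M.IsCircuit C ∧ C.ncard = 6 ∧ x ∈ C}.ncard
      = ∑ x ∈ M.ground_finite.toFinset, ∑ C ∈ Sf, (if x ∈ C then 1 else 0) := by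
        refine Finset.sum_congr rfl (fun x _ => ?_); rw [h1 x, Finset.card_filter]
    _ = ∑ C ∈ Sf, ∑ x ∈ M.ground_finite.toFinset, (if x ∈ C then 1 else 0) := Finset.sum_comm
    _ = ∑ C ∈ Sf, 6 := by
        refine Finset.sum_congr rfl (fun C hC => ?_); rw [← Finset.card_filter, h2 C hC]
    _ = 6 * {C : Set α | M.IsCircuit C ∧ C.ncard = 6}.ncard := by
        rw [Finset.sum_const, smul_eq_mul, mul_comm, hSf, ← ncard_eq_toFinset_card _ hS]

/-- A coloop lies on no 5-circuit. -/
theorem ncard_sixCircuitsThrough_eq_zero_of_isColoop (M : Matroid α) {x : α} (hx : M.IsColoop x) :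
    {C : Set α | M.IsCircuit C ∧ C.ncard = 6 ∧ x ∈ C}.ncard = 0 := by
  have : {C : Set α | M.IsCircuit C ∧ C.ncard = 6 ∧ x ∈ C} = ∅ := by
    ext C; simp only [mem_setOf_eq, mem_empty_iff_false, iff_false]
    rintro ⟨hC, _, hxC⟩
    exact hC.not_isColoop_of_mem hxC hx
  rw [this, ncard_empty]

open Classical in
/-- **Averaging**: if `s₆ > 0`, some non-coloop `x` lies on at most `⌊6·s₆ / m⌋` six-circuits, where `m` is the
number of non-coloops. -/
theorem exists_nonColoop_ncard_sixCircuitsThrough_le (M : Matroid α) [M.Finite]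
    (hpos : 0 < {C : Set α | M.IsCircuit C ∧ C.ncard = 6}.ncard) :
    ∃ x ∈ M.E, ¬ M.IsColoop x ∧ {C : Set α | M.IsCircuit C ∧ C.ncard = 6 ∧ x ∈ C}.ncard ≤
      6 * {C : Set α | M.IsCircuit C ∧ C.ncard = 6}.ncard /
        (M.ground_finite.toFinset.filter (fun x => ¬ M.IsColoop x)).card := by
  have hS : {C : Set α | M.IsCircuit C ∧ C.ncard = 6}.Finite :=
    M.ground_finite.finite_subsets.subset (fun C hC => hC.1.subset_ground)
  have hsum : ∑ x ∈ M.ground_finite.toFinset.filter (fun x => ¬ M.IsColoop x),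
      {C : Set α | M.IsCircuit C ∧ C.ncard = 6 ∧ x ∈ C}.ncard = 6 * {C : Set α | M.IsCircuit C ∧ C.ncard = 6}.ncard := by
    rw [Finset.sum_filter_of_ne]
    · exact sum_ncard_sixCircuitsThrough_eq M
    · intro x _ hfx hcol
      exact hfx (ncard_sixCircuitsThrough_eq_zero_of_isColoop M hcol)
  -- the non-coloops are nonempty: a point of a 5-circuit
  have hm : 0 < (M.ground_finite.toFinset.filter (fun x => ¬ M.IsColoop x)).card := by
    obtain ⟨C₀, hC₀⟩ := (ncard_pos hS).1 hpos
    obtain ⟨x₀, hx₀⟩ := hC₀.1.nonempty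
    refine Finset.card_pos.2 ⟨x₀, ?_⟩
    rw [Finset.mem_filter, Set.Finite.mem_toFinset]
    exact ⟨hC₀.1.subset_ground hx₀, hC₀.1.not_isColoop_of_mem hx₀⟩
  by_contra hno
  push Not at hno
  have hall : ∀ x ∈ M.ground_finite.toFinset.filter (fun x => ¬ M.IsColoop x),
      6 * {C : Set α | M.IsCircuit C ∧ C.ncard = 6}.ncard /
        (M.ground_finite.toFinset.filter (fun x => ¬ M.IsColoop x)).card + 1 ≤
        {C : Set α | M.IsCircuit C ∧ C.ncard = 6 ∧ x ∈ C}.ncard := by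
    intro x hx
    have hx' := hx
    rw [Finset.mem_filter, Set.Finite.mem_toFinset] at hx'
    have := hno x hx'.1 hx'.2
    omega
  have hge := Finset.card_nsmul_le_sum _ _ _ hall
  rw [smul_eq_mul, hsum] at hge
  have hdm := Nat.div_add_mod (6 * {C : Set α | M.IsCircuit C ∧ C.ncard = 6}.ncard)
    (M.ground_finite.toFinset.filter (fun x => ¬ M.IsColoop x)).card
  have hmod := Nat.mod_lt (6 * {C : Set α | M.IsCircuit C ∧ C.ncard = 6}.ncard) hm
  have hmul : (M.ground_finite.toFinset.filter (fun x => ¬ M.IsColoop x)).card *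
      (6 * {C : Set α | M.IsCircuit C ∧ C.ncard = 6}.ncard /
        (M.ground_finite.toFinset.filter (fun x => ¬ M.IsColoop x)).card + 1) =
      (M.ground_finite.toFinset.filter (fun x => ¬ M.IsColoop x)).card *
      (6 * {C : Set α | M.IsCircuit C ∧ C.ncard = 6}.ncard /
        (M.ground_finite.toFinset.filter (fun x => ¬ M.IsColoop x)).card) +
      (M.ground_finite.toFinset.filter (fun x => ¬ M.IsColoop x)).card := by ring
  omega

/-- The 6-circuits of `M` are at most those through `e` plus those of `M ＼ {e}` (p1's S1CoreSplit for `5`). -/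
theorem ncard_sixCircuits_le_through_add_delete (M : Matroid α) [M.Finite] (e : α) :
    {C : Set α | M.IsCircuit C ∧ C.ncard = 6}.ncard ≤
      {C : Set α | M.IsCircuit C ∧ C.ncard = 6 ∧ e ∈ C}.ncard +
        {C : Set α | (M ＼ {e}).IsCircuit C ∧ C.ncard = 6}.ncard := by
  classical
  set S := {C : Set α | M.IsCircuit C ∧ C.ncard = 6} with hS
  set S₁ := {C : Set α | M.IsCircuit C ∧ C.ncard = 6 ∧ e ∈ C} with hS₁
  set S₂ := {C : Set α | (M ＼ {e}).IsCircuit C ∧ C.ncard = 6} with hS₂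
  have hS₁fin : S₁.Finite :=
    M.ground_finite.finite_subsets.subset (fun C hC => hC.1.subset_ground)
  have hS₂fin : S₂.Finite :=
    (M ＼ {e}).ground_finite.finite_subsets.subset (fun C hC => hC.1.subset_ground)
  have hsplit : S ⊆ S₁ ∪ S₂ := by
    intro C hC
    by_cases h : e ∈ C
    · exact Or.inl ⟨hC.1, hC.2, h⟩
    · exact Or.inr ⟨_root_.Matroid.delete_isCircuit_iff.2 ⟨hC.1, disjoint_singleton_right.2 h⟩, hC.2⟩
  calc S.ncard ≤ (S₁ ∪ S₂).ncard := ncard_le_ncard hsplit (hS₁fin.union hS₂fin)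
    _ ≤ S₁.ncard + S₂.ncard := ncard_union_le _ _

open Classical in
/-- **The averaging recursion for the 6-circuits**: on a core of nullity `d + 1` with `d ≥ 6`, if every core of
nullity `d` has `s₆ ≤ B`, then `s₆ − ⌊6·s₆/(d + 6)⌋ ≤ B`. -/
theorem ncard_sixCircuits_sub_div_le (M : Matroid α) [M.Finite]
    (hfree : ∀ e ∈ M.E, ∃ A ⊆ M.E \ {e}, e ∉ M.closure A ∧ e ∉ M.closure ((M.E \ {e}) \ A))
    {d : ℕ} (hd : M.E.encard = M.eRank + (d + 1)) (hd6 : 6 ≤ d) {B : ℕ}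
    (hB : ∀ (M' : Matroid α) [M'.Finite],
      (∀ e ∈ M'.E, ∃ A ⊆ M'.E \ {e}, e ∉ M'.closure A ∧ e ∉ M'.closure ((M'.E \ {e}) \ A)) →
      M'.E.encard = M'.eRank + d → {C : Set α | M'.IsCircuit C ∧ C.ncard = 6}.ncard ≤ B) :
    {C : Set α | M.IsCircuit C ∧ C.ncard = 6}.ncard -
      6 * {C : Set α | M.IsCircuit C ∧ C.ncard = 6}.ncard / (d + 6) ≤ B := by
  rcases Nat.eq_zero_or_pos {C : Set α | M.IsCircuit C ∧ C.ncard = 6}.ncard with h0 | hpos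
  · rw [h0]; simp
  obtain ⟨x, hxE, hxc, hx⟩ := exists_nonColoop_ncard_sixCircuitsThrough_le M hpos
  -- the non-coloops number at least `d + 6`
  have hm : d + 6 ≤ (M.ground_finite.toFinset.filter (fun x => ¬ M.IsColoop x)).card := by
    have : (M.ground_finite.toFinset.filter (fun x => ¬ M.IsColoop x) : Set α) = M.E \ M.coloops := by
      ext y; simp only [Finset.coe_filter, Set.Finite.mem_toFinset, mem_setOf_eq, mem_sdiff,
        Matroid.isColoop_iff_mem_coloops]
    rw [← ncard_coe_finset, this]
    exact S1.card_nonColoops_ge M hfree hd hd6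
  have hx' : {C : Set α | M.IsCircuit C ∧ C.ncard = 6 ∧ x ∈ C}.ncard ≤
      6 * {C : Set α | M.IsCircuit C ∧ C.ncard = 6}.ncard / (d + 6) :=
    hx.trans (Nat.div_le_div_left hm (by omega))
  -- `M ＼ {x}` is a core of nullity `d`
  have hν : M✶.eRank = ((d + 1 : ℕ) : ℕ∞) := by
    have h := _root_.Matroid.eRank_add_eRank_dual M
    rw [hd] at h
    exact WithTop.add_left_cancel (PercRepro.Matroid.eRank_ne_top_of_finite M) h
  have hdel := PercRepro.Matroid.dual_eRank_delete_singleton_add_one hxE hxc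
  rw [hν] at hdel
  have hfin' : (M ＼ {x})✶.eRank ≠ ⊤ := by
    intro h
    rw [h] at hdel
    have h2 : ((d + 1 : ℕ) : ℕ∞) = ⊤ := by rw [← hdel]; simp
    exact ENat.coe_ne_top _ h2
  obtain ⟨d', hd'⟩ := ENat.ne_top_iff_exists.1 hfin'
  have hdd' : d = d' := by
    rw [← hd'] at hdel
    have : d' + 1 = d + 1 := by exact_mod_cast hdel
    omega
  subst hdd'
  have hd'enc : (M ＼ {x}).E.encard = (M ＼ {x}).eRank + d := by
    have h := _root_.Matroid.eRank_add_eRank_dual (M ＼ {x})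
    rw [← hd'] at h
    exact h.symm
  have hB' := hB (M ＼ {x}) (S1.hfree_delete M hfree x) hd'enc
  have hsplit := ncard_sixCircuits_le_through_add_delete M x
  omega

open Classical in
/-- **The 6-circuit averaging step with an explicit non-coloop count**: on a core of nullity `d + 1` with at least `m`
non-coloops, if every core of nullity `d` has `s₆ ≤ B`, then `s₆ − ⌊6·s₆/m⌋ ≤ B` (RankLevelSetSixCircuitAvg's
`ncard_sixCircuits_sub_div_le` with `m` in place of `d + 6`). -/
theorem ncard_sixCircuits_sub_div_le_of_nonColoops (M : Matroid α) [M.Finite]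
    (hfree : ∀ e ∈ M.E, ∃ A ⊆ M.E \ {e}, e ∉ M.closure A ∧ e ∉ M.closure ((M.E \ {e}) \ A))
    {d : ℕ} (hd : M.E.encard = M.eRank + (d + 1)) {m : ℕ} (hm0 : 0 < m)
    (hm : m ≤ (M.E \ M.coloops).ncard) {B : ℕ}
    (hB : ∀ (M' : Matroid α) [M'.Finite],
      (∀ e ∈ M'.E, ∃ A ⊆ M'.E \ {e}, e ∉ M'.closure A ∧ e ∉ M'.closure ((M'.E \ {e}) \ A)) →
      M'.E.encard = M'.eRank + d → {C : Set α | M'.IsCircuit C ∧ C.ncard = 6}.ncard ≤ B) :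
    {C : Set α | M.IsCircuit C ∧ C.ncard = 6}.ncard -
      6 * {C : Set α | M.IsCircuit C ∧ C.ncard = 6}.ncard / m ≤ B := by
  rcases Nat.eq_zero_or_pos {C : Set α | M.IsCircuit C ∧ C.ncard = 6}.ncard with h0 | hpos
  · rw [h0]; simp
  obtain ⟨x, hxE, hxc, hx⟩ := exists_nonColoop_ncard_sixCircuitsThrough_le M hpos
  -- the non-coloops number at least `m`
  have hm' : m ≤ (M.ground_finite.toFinset.filter (fun x => ¬ M.IsColoop x)).card := by
    have : (M.ground_finite.toFinset.filter (fun x => ¬ M.IsColoop x) : Set α) = M.E \ M.coloops := by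
      ext y; simp only [Finset.coe_filter, Set.Finite.mem_toFinset, mem_setOf_eq, mem_sdiff,
        Matroid.isColoop_iff_mem_coloops]
    rw [← ncard_coe_finset, this]
    exact hm
  have hx' : {C : Set α | M.IsCircuit C ∧ C.ncard = 6 ∧ x ∈ C}.ncard ≤
      6 * {C : Set α | M.IsCircuit C ∧ C.ncard = 6}.ncard / m :=
    hx.trans (Nat.div_le_div_left hm' hm0)
  -- `M ＼ {x}` is a core of nullity `d`
  have hν : M✶.eRank = ((d + 1 : ℕ) : ℕ∞) := by
    have h := _root_.Matroid.eRank_add_eRank_dual M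
    rw [hd] at h
    exact WithTop.add_left_cancel (PercRepro.Matroid.eRank_ne_top_of_finite M) h
  have hdel := PercRepro.Matroid.dual_eRank_delete_singleton_add_one hxE hxc
  rw [hν] at hdel
  have hfin' : (M ＼ {x})✶.eRank ≠ ⊤ := by
    intro h
    rw [h] at hdel
    have h2 : ((d + 1 : ℕ) : ℕ∞) = ⊤ := by rw [← hdel]; simp
    exact ENat.coe_ne_top _ h2
  obtain ⟨d', hd'⟩ := ENat.ne_top_iff_exists.1 hfin'
  have hdd' : d = d' := by
    rw [← hd'] at hdel
    have : d' + 1 = d + 1 := by exact_mod_cast hdel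
    omega
  subst hdd'
  have hd'enc : (M ＼ {x}).E.encard = (M ＼ {x}).eRank + d := by
    have h := _root_.Matroid.eRank_add_eRank_dual (M ＼ {x})
    rw [← hd'] at h
    exact h.symm
  have hB' := hB (M ＼ {x}) (S1.hfree_delete M hfree x) hd'enc
  have hsplit := ncard_sixCircuits_le_through_add_delete M x
  omega

end ThmN

end PercRepro
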